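import Summits.QuantumFields.YangMills.Theorems.FluctuationComparisonRegPrIntLOrganTangentD0ChartLettersWhitened
import Literature.MathematicalPhysics.QuantumFieldTheory.Balaban1983to89.T4ExpWindowSmallField
import HarnessLib

/-!
# Crux `FluctuationComparisonRegPrIntL` (stmt-QuantumFields-20520, rung R3), PATH-B organ (covariant organ of record, RULING №56) — (L56) «THE (I-geo)sq DISPLACEMENT LETTER `hdisp`
# FROM THE D0 PRIMITIVES» (LEAD w3 g28 №37: «YES — GO, with the TN-HDISP-FRAME convention made explicit»; (I-geo)sq STAYS a row letter of record, text unchanged — this file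
# makes it a THEOREM of the primitives): ✓p823910's `hdisp` binder text (top-level plaquette displacement of the chart under a coarse one-bond move, for EVERY fibre point `z`)
# ⟸ (Φw) + (Dmin′) + (Dwhite′) in TWO `z`-REGIMES, via lit ✓`T4ExpWindowSmallField.dist1_plaqHol_le_add` (plaquette variables move by at most the plaquette deviation)

Cell `ym3-torus` (YM ladder rung R3 = continuum `SU(2)` Yang–Mills on the three-torus — a RUNG: NOT d = 4, NOT infinite volume, NOT a mass gap, NOT Clay).
Width seat `ym-ust-20520-w5` (gen 26), `--kind proof --supports stmt-QuantumFields-20520 --as helper`, count-neutral, DEFINITION-FREE, default heartbeats,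
no registry ∕ binder ∕ `Lines/` edit.  Over ✓p827724 (L50a) `…OrganTangentSU2RightIncrements` (`exists_expPt_eq_expPt_mul`, `exists_rightIncr_comp`), ✓p827906 (L50b)
(`incr_norm_le`), lit ✓`T4ExpWindowSmallField` (`dist1_plaqHol_le_add`, `plaqDev`, `dist1_expPt_le_of_mem_cube`), lit `T4TiltOscillation.bdev`.

THE LETTERS (one-sided window, TN-HDISP-FRAME convention — LEAD №37):
* (Dmin′) «`PlaqSmall θ_j V → ‖u‖ ≤ δ₀ → ∀ e, ∃ a, Amin V′ e = Amin V e·expPt a ∧ ‖a‖ ≤ kA e·‖u‖`», `V′ := update V b (V b·expPt u)` — (Dmin) with NO smallness premise on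
  the moved field `V′` (`hdisp`'s base `X` is merely `θ_j`-small, so `V′` leaves the `θ_j`-window by `√3·rc·θ_j∕4`; the D0 typer states (Dmin) on the ENLARGED window
  `PlaqSmall (θ_j·(1 + √3·rc∕4)) ⊆ PlaqSmall (2θ_j)` and feeds the row's `θ_j`-smallness by monotonicity — [Balaban1985Variational] Prop. 9 (190) with (172)'s nesting).
* (Dwhite′), TWO `z`-REGIMES: ON the chart domain `Dom ⊆ Z` (the bounded slice of V-independent radius — w4 g24 TN-HDISP-FRAME, SPEC §3∕D0) «`z ∈ Dom → PlaqSmall θ_j V →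
  ‖u‖ ≤ δ₀ → ∀ e, ‖Wh V′ z e − Wh V z e‖ ≤ kW e·‖u‖`» (`Wh V z = K_V^{−1∕2}z` is LINEAR in `z`, so `kW e` absorbs the slice radius); OFF the domain «`z ∉ Dom → Wh V z e = 0`»
  (there `Φ(V,z) = Amin V` and the displacement is (Dmin′)'s alone).  No multiwindow premise: `hdisp` is `∀ z` by design.
* (Φw) = ✓(L50b)'s structure letter; `hk : ∀ e, (π∕2)·√3·(√3·kA e + (π∕2)·√3·kW e) ≤ k e` (the consumer's modulus dominates the two-point D0 modulus); guard `rc·(θ_j∕4) ≤ δ₀`.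
INHABITATION (★★OWNER RULING №100): LAW-FREE — statements about the chart objects pointwise in `z`.

WHAT.  §1 [folklore] ★`dwhite_global_of_regimes` (the two regimes ⟹ (Dwhite′) for every `z`), ★★`dlink_twoPoint` ((Φw) + (Dmin′) + (Dwhite′) ⟹ `∀ z V b u, PlaqSmall θ_j V →
‖u‖ ≤ δ₀ → ∀ e, ∃ w, Φ (V′,z) e = Φ (V,z) e·expPt w ∧ ‖w‖ ≤ k e·‖u‖`), ★`dist1_bdev_le_of_rightIncr` (`Φ′ e = Φ e·expPt w`, `‖w‖ ≤ c` ⟹ `dist1 (bdev Φ′ Φ e) ≤ √3·c`).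
§2 ★★★`hdisp_of_primitives` — ✓p823910's `hdisp` binder text with `DP p b := √3·(θ_j∕4)·(k ⟨p.src, p.μ⟩ + k ⟨p.src.shift p.μ, p.ν⟩ + k ⟨p.src.shift p.ν, p.μ⟩ + k ⟨p.src, p.ν⟩)`
(the four letters of `∂p`, as in lit `plaqDev`; `b`-independent): `dist1 (Φ(X′,z)(∂p)) ≤ dist1 (Φ(X,z)(∂p)) + DP p b·(‖v‖∕(θ_j∕4))` for `X` `θ_j`-small, `‖v‖ ≤ rc·(θ_j∕4)`, `s ∈ [0,1]`,
`X′ = update X b (X b·expPt (s•v))`.  So the consumer's `hDb : ∀ p b, DP p b ≤ Db` reads `√3·(θ_j∕4)·(four moduli) ≤ Db`.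

HONEST FRAMING: a door between HYPOTHESIS letters; (Dmin′), (Dwhite′), (Φw), the domain `Dom` are D0's content (crux 19200 EX ∧ V2′) and NOT proved here; (I-geo)sq remains the
row's letter of record (this file supplies it from the primitives); nothing of Bałaban's analysis is asserted or proved; (I-curv), (I-cov), KER′ letters, rows v0.1–v0.4
UNDISCHARGED; the five registered stubs of `Lines/semiclassical_s2beta.lean`, crux 20520 and `YM3TorusSU2` are NOT proved; registry untouched; rung R3 = SU(2) YM₃ on T³ — NOT
d = 4, NOT infinite volume, NOT a mass gap, NOT Clay; the Yang–Mills mass gap is NOT proved.  [folklore]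
-/

set_option autoImplicit false

noncomputable section

namespace Summit.QuantumFields.YangMills.Theorems.OrganTangentHdispOfD0Primitives

open Function Set
open scoped NNReal
open Literature.MathematicalPhysics.QuantumFieldTheory
open Literature.MathematicalPhysics.QuantumFieldTheory.Balaban1983to89 T3ContinuumYM3Torus T3NestedUnitLaws
  T3UnitLawDensityEML T4Continuum BalabanUVClass T3UnitScaleTilt T3LevelShift T3TiltDescent
open T4CubeChartExp (expPt expPt_zero)
open T4TiltOscillation (bdev)
open T4ExpWindowSmallField (plaqDev dist1_plaqHol_le_add dist1_expPt_le_of_mem_cube)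
open Summit.QuantumFields.YangMills.Theorems.OrganTangentSU2RightIncrements (exists_expPt_eq_expPt_mul exists_rightIncr_comp)

/-! ## §1 Two-point bond increments of the chart from the primitives -/

section TwoPoint

variable {Z : Type}

/-- ★ **(Dwhite′) FOR EVERY `z` FROM THE TWO REGIMES** (TN-HDISP-FRAME): on the chart domain the letter, off it `Wh ≡ 0`. [folklore] -/
theorem dwhite_global_of_regimes (F : T3Family) (γ b₀ p₀ : ℝ) (j Ts : ℕ)
    (Wh : GaugeField (F.P j) 0 ↥(Matrix.specialUnitaryGroup (Fin 2) ℂ) → Z → PBond (F.P Ts) 0 → (Fin 3 → ℝ)) (Dom : Set Z) (δ₀ : ℝ)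
    (kW : PBond (F.P Ts) 0 → ℝ) (hkW0 : ∀ e, 0 ≤ kW e)
    (hWhOff : ∀ (V : GaugeField (F.P j) 0 ↥(Matrix.specialUnitaryGroup (Fin 2) ℂ)) (z : Z), z ∉ Dom → ∀ e, Wh V z e = 0)
    (hDwhiteOn : ∀ z ∈ Dom, ∀ (V : GaugeField (F.P j) 0 ↥(Matrix.specialUnitaryGroup (Fin 2) ℂ)) (b : PBond (F.P j) 0) (u : Fin 3 → ℝ),
      PlaqSmall (θBal F.L γ b₀ p₀ j) V → ‖u‖ ≤ δ₀ → ∀ e, ‖Wh (update V b (V b * expPt u)) z e - Wh V z e‖ ≤ kW e * ‖u‖) :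
    ∀ (z : Z) (V : GaugeField (F.P j) 0 ↥(Matrix.specialUnitaryGroup (Fin 2) ℂ)) (b : PBond (F.P j) 0) (u : Fin 3 → ℝ),
      PlaqSmall (θBal F.L γ b₀ p₀ j) V → ‖u‖ ≤ δ₀ → ∀ e, ‖Wh (update V b (V b * expPt u)) z e - Wh V z e‖ ≤ kW e * ‖u‖ := by
  intro z V b u hV hu e
  by_cases hz : z ∈ Dom
  · exact hDwhiteOn z hz V b u hV hu e
  · rw [hWhOff _ z hz e, hWhOff V z hz e, sub_self, norm_zero]
    exact mul_nonneg (hkW0 e) (norm_nonneg u)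

/-- ★★ **THE TWO-POINT LINK INCREMENT OF THE CHART FROM (Φw) + (Dmin′) + (Dwhite′)**: `Φ (V′, z) e = Φ (V, z) e·expPt w`, `‖w‖ ≤ k e·‖u‖`, for every `z`, every
`θ_j`-small `V`, every one-bond move of size `≤ δ₀` (✓`exists_expPt_eq_expPt_mul`, ✓`exists_rightIncr_comp`, ✓`incr_norm_le`). [folklore] -/
theorem dlink_twoPoint (F : T3Family) (γ b₀ p₀ : ℝ) (j Ts : ℕ)
    (Φ : GaugeField (F.P j) 0 ↥(Matrix.specialUnitaryGroup (Fin 2) ℂ) × Z → GaugeField (F.P Ts) 0 ↥(Matrix.specialUnitaryGroup (Fin 2) ℂ))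
    (Amin : GaugeField (F.P j) 0 ↥(Matrix.specialUnitaryGroup (Fin 2) ℂ) → GaugeField (F.P Ts) 0 ↥(Matrix.specialUnitaryGroup (Fin 2) ℂ))
    (Wh : GaugeField (F.P j) 0 ↥(Matrix.specialUnitaryGroup (Fin 2) ℂ) → Z → PBond (F.P Ts) 0 → (Fin 3 → ℝ))
    (hΦw : ∀ V z e, Φ (V, z) e = Amin V e * expPt (Wh V z e)) (δ₀ : ℝ)
    (kA kW k : PBond (F.P Ts) 0 → ℝ)
    (hk : ∀ e, Real.pi / 2 * Real.sqrt 3 * (Real.sqrt 3 * kA e + Real.pi / 2 * Real.sqrt 3 * kW e) ≤ k e)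
    (hDmin : ∀ (V : GaugeField (F.P j) 0 ↥(Matrix.specialUnitaryGroup (Fin 2) ℂ)) (b : PBond (F.P j) 0) (u : Fin 3 → ℝ), PlaqSmall (θBal F.L γ b₀ p₀ j) V → ‖u‖ ≤ δ₀ →
      ∀ e, ∃ a : Fin 3 → ℝ, Amin (update V b (V b * expPt u)) e = Amin V e * expPt a ∧ ‖a‖ ≤ kA e * ‖u‖)
    (hDwhite : ∀ (z : Z) (V : GaugeField (F.P j) 0 ↥(Matrix.specialUnitaryGroup (Fin 2) ℂ)) (b : PBond (F.P j) 0) (u : Fin 3 → ℝ),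
      PlaqSmall (θBal F.L γ b₀ p₀ j) V → ‖u‖ ≤ δ₀ → ∀ e, ‖Wh (update V b (V b * expPt u)) z e - Wh V z e‖ ≤ kW e * ‖u‖) :
    ∀ (z : Z) (V : GaugeField (F.P j) 0 ↥(Matrix.specialUnitaryGroup (Fin 2) ℂ)) (b : PBond (F.P j) 0) (u : Fin 3 → ℝ),
      PlaqSmall (θBal F.L γ b₀ p₀ j) V → ‖u‖ ≤ δ₀ →
      ∀ e, ∃ w : Fin 3 → ℝ, Φ (update V b (V b * expPt u), z) e = Φ (V, z) e * expPt w ∧ ‖w‖ ≤ k e * ‖u‖ := by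
  intro z V b u hV hu e
  obtain ⟨a, ha, hale⟩ := hDmin V b u hV hu e
  have hwh := hDwhite z V b u hV hu e
  obtain ⟨c, hc, hcle⟩ := exists_expPt_eq_expPt_mul (Wh V z e) (Wh (update V b (V b * expPt u)) z e)
  obtain ⟨w, hw, hwle⟩ := exists_rightIncr_comp (Amin V e) (Amin (update V b (V b * expPt u)) e) (Wh V z e) (Wh (update V b (V b * expPt u)) z e) a c ha hc
  refine ⟨w, by rw [hΦw, hΦw]; exact hw, hwle.trans ?_⟩
  have hc' : ‖c‖ ≤ Real.pi / 2 * (Real.sqrt 3 * (kW e * ‖u‖)) :=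
    hcle.trans (mul_le_mul_of_nonneg_left (mul_le_mul_of_nonneg_left hwh (Real.sqrt_nonneg 3)) (by positivity))
  calc Real.pi / 2 * (Real.sqrt 3 * (Real.sqrt 3 * ‖a‖ + ‖c‖))
      ≤ Real.pi / 2 * (Real.sqrt 3 * (Real.sqrt 3 * (kA e * ‖u‖) + Real.pi / 2 * (Real.sqrt 3 * (kW e * ‖u‖)))) := by
        gcongr
    _ = (Real.pi / 2 * Real.sqrt 3 * (Real.sqrt 3 * kA e + Real.pi / 2 * Real.sqrt 3 * kW e)) * ‖u‖ := by ring
    _ ≤ k e * ‖u‖ := mul_le_mul_of_nonneg_right (hk e) (norm_nonneg u)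

/-- ★ **A RIGHT INCREMENT BOUNDS THE BOND DEVIATION**: `U′ e = U e·expPt w`, `‖w‖ ≤ c` ⟹ `dist1 (bdev U′ U e) ≤ √3·c` (`bdev U′ U e = (U e)⁻¹·U′ e = expPt w`,
`dist1 (expPt w) ≤ √3·‖w‖_∞`). [folklore] -/
theorem dist1_bdev_le_of_rightIncr {P : Params} {i : ℕ} (U U' : GaugeField P i ↥(Matrix.specialUnitaryGroup (Fin 2) ℂ)) (e : PBond P i)
    {w : Fin 3 → ℝ} {c : ℝ} (hU : U' e = U e * expPt w) (hw : ‖w‖ ≤ c) :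
    dist1 (bdev U' U e) ≤ Real.sqrt 3 * c := by
  have hb : bdev U' U e = expPt w := by rw [bdev, hU, inv_mul_cancel_left]
  rw [hb]
  refine (dist1_expPt_le_of_mem_cube (S := ‖w‖) (T4CubePoincare.mem_cube_iff.2 fun i => ?_)).trans
    (mul_le_mul_of_nonneg_left hw (Real.sqrt_nonneg 3))
  rw [← Real.norm_eq_abs]; exact norm_le_pi_norm w i

end TwoPoint

/-! ## §2 ✓p823910's `hdisp` from the primitives -/

section Hdisp

variable {Z : Type}

/-- ★★★ **THE (I-geo)sq DISPLACEMENT LETTER FROM THE D0 PRIMITIVES** — ✓p823910's `hdisp` binder text with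
`DP p b := √3·(θ_j∕4)·(k ⟨p.src, p.μ⟩ + k ⟨p.src.shift p.μ, p.ν⟩ + k ⟨p.src.shift p.ν, p.μ⟩ + k ⟨p.src, p.ν⟩)` ⟸ (Φw) + (Dmin′) + (Dwhite′) in two `z`-regimes + `hk` +
the guard `rc·(θ_j∕4) ≤ δ₀` (lit ✓`dist1_plaqHol_le_add`: `dist1 (U(∂p)) ≤ dist1 (U₀(∂p)) + plaqDev U U₀ p`). [cite: Balaban1985Variational, Prop. 9 (190) p.308] -/
theorem hdisp_of_primitives (F : T3Family) (γ b₀ p₀ : ℝ) (j Ts : ℕ)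
    (Φ : GaugeField (F.P j) 0 ↥(Matrix.specialUnitaryGroup (Fin 2) ℂ) × Z → GaugeField (F.P Ts) 0 ↥(Matrix.specialUnitaryGroup (Fin 2) ℂ))
    (Amin : GaugeField (F.P j) 0 ↥(Matrix.specialUnitaryGroup (Fin 2) ℂ) → GaugeField (F.P Ts) 0 ↥(Matrix.specialUnitaryGroup (Fin 2) ℂ))
    (Wh : GaugeField (F.P j) 0 ↥(Matrix.specialUnitaryGroup (Fin 2) ℂ) → Z → PBond (F.P Ts) 0 → (Fin 3 → ℝ))
    (hΦw : ∀ V z e, Φ (V, z) e = Amin V e * expPt (Wh V z e))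
    (rc δ₀ : ℝ) (hθj : 0 < θBal F.L γ b₀ p₀ j) (hδ₀ : rc * (θBal F.L γ b₀ p₀ j / 4) ≤ δ₀)
    (kA kW k : PBond (F.P Ts) 0 → ℝ) (hkA0 : ∀ e, 0 ≤ kA e) (hkW0 : ∀ e, 0 ≤ kW e)
    (hk : ∀ e, Real.pi / 2 * Real.sqrt 3 * (Real.sqrt 3 * kA e + Real.pi / 2 * Real.sqrt 3 * kW e) ≤ k e)
    -- (Dmin′): one-sided window
    (hDmin : ∀ (V : GaugeField (F.P j) 0 ↥(Matrix.specialUnitaryGroup (Fin 2) ℂ)) (b : PBond (F.P j) 0) (u : Fin 3 → ℝ), PlaqSmall (θBal F.L γ b₀ p₀ j) V → ‖u‖ ≤ δ₀ →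
      ∀ e, ∃ a : Fin 3 → ℝ, Amin (update V b (V b * expPt u)) e = Amin V e * expPt a ∧ ‖a‖ ≤ kA e * ‖u‖)
    -- (Dwhite′): the two z-regimes (TN-HDISP-FRAME)
    (Dom : Set Z)
    (hWhOff : ∀ (V : GaugeField (F.P j) 0 ↥(Matrix.specialUnitaryGroup (Fin 2) ℂ)) (z : Z), z ∉ Dom → ∀ e, Wh V z e = 0)
    (hDwhiteOn : ∀ z ∈ Dom, ∀ (V : GaugeField (F.P j) 0 ↥(Matrix.specialUnitaryGroup (Fin 2) ℂ)) (b : PBond (F.P j) 0) (u : Fin 3 → ℝ),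
      PlaqSmall (θBal F.L γ b₀ p₀ j) V → ‖u‖ ≤ δ₀ → ∀ e, ‖Wh (update V b (V b * expPt u)) z e - Wh V z e‖ ≤ kW e * ‖u‖) :
    ∀ (z : Z) (X : GaugeField (F.P j) 0 ↥(Matrix.specialUnitaryGroup (Fin 2) ℂ)), PlaqSmall (θBal F.L γ b₀ p₀ j) X →
      ∀ (b : PBond (F.P j) 0) (v : Fin 3 → ℝ), ‖v‖ ≤ rc * (θBal F.L γ b₀ p₀ j / 4) → ∀ s ∈ Icc (0 : ℝ) 1, ∀ p : Plaq (F.P Ts) 0,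
        dist1 (GaugeField.plaqHol (Φ (update X b (X b * expPt (s • v)), z)) p)
          ≤ dist1 (GaugeField.plaqHol (Φ (X, z)) p) +
            (Real.sqrt 3 * (θBal F.L γ b₀ p₀ j / 4) * (k ⟨p.src, p.μ⟩ + k ⟨p.src.shift p.μ, p.ν⟩ + k ⟨p.src.shift p.ν, p.μ⟩ + k ⟨p.src, p.ν⟩)) *
              (‖v‖ / (θBal F.L γ b₀ p₀ j / 4)) := by
  intro z X hX b v hv s hs p
  have hθ4 : 0 < θBal F.L γ b₀ p₀ j / 4 := by positivity
  have hsv : ‖s • v‖ ≤ ‖v‖ := by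
    rw [norm_smul, Real.norm_eq_abs, abs_of_nonneg hs.1]
    exact (mul_le_mul_of_nonneg_right hs.2 (norm_nonneg v)).trans_eq (one_mul _)
  have hu : ‖s • v‖ ≤ δ₀ := hsv.trans (hv.trans hδ₀)
  have hD := dlink_twoPoint F γ b₀ p₀ j Ts Φ Amin Wh hΦw δ₀ kA kW k hk hDmin
    (dwhite_global_of_regimes F γ b₀ p₀ j Ts Wh Dom δ₀ kW hkW0 hWhOff hDwhiteOn) z X b (s • v) hX hu
  -- the four bond deviations around `∂p`
  have hbd : ∀ e : PBond (F.P Ts) 0,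
      dist1 (bdev (Φ (update X b (X b * expPt (s • v)), z)) (Φ (X, z)) e) ≤ Real.sqrt 3 * (k e * ‖v‖) := by
    intro e
    obtain ⟨w, hw, hwle⟩ := hD e
    have hk0 : 0 ≤ k e :=
      le_trans (mul_nonneg (by positivity) (add_nonneg (mul_nonneg (Real.sqrt_nonneg 3) (hkA0 e)) (mul_nonneg (by positivity) (hkW0 e)))) (hk e)
    exact dist1_bdev_le_of_rightIncr _ _ e hw (hwle.trans (mul_le_mul_of_nonneg_left hsv hk0))
  have hdev : plaqDev (Φ (update X b (X b * expPt (s • v)), z)) (Φ (X, z)) p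
      ≤ Real.sqrt 3 * ((k ⟨p.src, p.μ⟩ + k ⟨p.src.shift p.μ, p.ν⟩ + k ⟨p.src.shift p.ν, p.μ⟩ + k ⟨p.src, p.ν⟩) * ‖v‖) := by
    unfold plaqDev
    have h1 := hbd ⟨p.src, p.μ⟩
    have h2 := hbd ⟨p.src.shift p.μ, p.ν⟩
    have h3 := hbd ⟨p.src.shift p.ν, p.μ⟩
    have h4 := hbd ⟨p.src, p.ν⟩
    nlinarith [h1, h2, h3, h4, Real.sqrt_nonneg 3]
  calc dist1 (GaugeField.plaqHol (Φ (update X b (X b * expPt (s • v)), z)) p)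
      ≤ dist1 (GaugeField.plaqHol (Φ (X, z)) p) + plaqDev (Φ (update X b (X b * expPt (s • v)), z)) (Φ (X, z)) p := dist1_plaqHol_le_add _ _ p
    _ ≤ dist1 (GaugeField.plaqHol (Φ (X, z)) p) +
          Real.sqrt 3 * ((k ⟨p.src, p.μ⟩ + k ⟨p.src.shift p.μ, p.ν⟩ + k ⟨p.src.shift p.ν, p.μ⟩ + k ⟨p.src, p.ν⟩) * ‖v‖) := add_le_add le_rfl hdev
    _ = dist1 (GaugeField.plaqHol (Φ (X, z)) p) +
          (Real.sqrt 3 * (θBal F.L γ b₀ p₀ j / 4) * (k ⟨p.src, p.μ⟩ + k ⟨p.src.shift p.μ, p.ν⟩ + k ⟨p.src.shift p.ν, p.μ⟩ + k ⟨p.src, p.ν⟩)) *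
            (‖v‖ / (θBal F.L γ b₀ p₀ j / 4)) := by
        field_simp

end Hdisp

end Summit.QuantumFields.YangMills.Theorems.OrganTangentHdispOfD0Primitives

end
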